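import Summits.QuantumFields.YangMills.Theorems.UnitScaleTiltFluctuationComparisonRegPrRepAtHeightsTrivRow
import Summits.QuantumFields.YangMills.Theorems.UnitScaleTiltFluctuationComparisonRegPrRepAtHeightsWinCover
import Summits.QuantumFields.YangMills.Theorems.AlphaInputsT3ACv3Step
import HarnessLib

/-!
# Crux `FluctuationComparisonRegPrL` (stmt-QuantumFields-19935), line v5h STUB 3′ `stub_alphaTwoRunOfLane`, conjunct (A) `RepAtHeights`:
# the consumer side BY NAME of the lane's v3 residual row `PinnedStep.Fibre55WinAC` (★pub-balaban3d-alpha-1, `Theorems/AlphaInputsT3ACv3Step.lean`)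
# — R-g18-a EDITION (route owner RULING g22-№5: the WINDOWED left weight `wtP_k(proj h′)`, print's `χ_k` of (49) p.268)

Fleet seat `ym-ust-19201-p2` (gen 4, socket pen; gen 7, named row W-g22-1).  WHAT THIS FILE DOES.  ★alpha-1's v3 residual row
`PinnedStep.Fibre55WinAC 𝔎 X 𝔖 win k h′` ([Balaban1985UV3] (55) p.269 with print's `χ_{k+1}` window on the right, the PINNED exact-transport masses
`MassesPAC.massRecP`, `M(triv) = 1`, and — R-g18-a — the WINDOWED pinned weight `wtP_k(proj h′) = 𝟙[win_{k−1}(proj h′)]·M_k(proj h′)`, `wtP_0 = 1`, on the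
left) is, AT THE TRIVIAL NEW HISTORY `h′ = triv`, the mass-free trivial-history row that gen 3 of this seat stated INLINE as the hypothesis `hrow` of
`AlphaInputsT3AC.OfV2At.repAtHeights_dataT3c_of_fibre55Triv` (p505372; crux-idea C5 `unfactored-trivial-row`) AS SOON AS the window of the old trivial
history covers the support of the small-field factor `χB_k(triv′)` (hypothesis `hsupp`; `…RepAtHeightsWinCover`): the step weight `w_k(triv′) = 1`
(`Carriers.stepWeight_triv`), the windowed weight is `1` on that support, the new pinned mass is `1` (`MassesPAC.massRecP_triv`), and the window indicator
on the right is `≤ 1`.  §1 proves this reduction for the lane's AC tower over ANY scales / AC inputs / window family (`fibre55Triv_of_fibre55WinAC`, a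
one-line reading of `LogComparisonRepAtHeights.fibre55Triv_of_windowedRow`); §2 instantiates it at the T³ v2 package `OfV2At.pkgAtV2` and composes with
p505372: **conjunct (A) of STUB 3′ at the lane's datum ⟸ `OfV2At` ∧ (∀ K, ∀ k < K, `Fibre55WinAC` at `triv` for a window family covering `χB_k(triv′)`)
∧ the adapter's thresholds** (`repAtHeights_dataT3c_of_fibre55Win`), and — the covering DISCHARGED for print's (40) windows `AlphaInputsT3AC.admWindowT3`
(`AlphaInputsT3AC.wtP_admWindowT3_triv_eq_one`) — **⟸ `OfV2At` ∧ the rows at the admissible windows ∧ thresholds** (`repAtHeights_dataT3c_of_fibre55WinAdm`):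
for the admissible window family nothing downstream of the trivial row changes under R-g18-a.  CONDITIONAL on that row (a hypothesis schema of the lane,
never asserted here); no Haar compatibility, no floored mass. [cite: Balaban1985UV3, (41) p.266, (47) p.267, (55)-(58) pp.269-270]

References: T. Bałaban, CMP 102 (1985) 255–275 [Balaban1985UV3] ((40)–(41) p.266, (47)–(49) pp.267–268, (55)–(58) pp.269–270, p.272 L32–33).
-/

set_option autoImplicit false

noncomputable section

namespace Summit.QuantumFields.YangMills.Theorems

open MeasureTheory Filter
open Literature.MathematicalPhysics.QuantumFieldTheory.Balaban1983to89
open Literature.MathematicalPhysics.QuantumFieldTheory.Balaban1983to89.AveragingRT (rnTransport)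
open Literature.MathematicalPhysics.QuantumFieldTheory.Balaban1983to89.T3ContinuumYM3Torus
open Literature.MathematicalPhysics.QuantumFieldTheory.Balaban1983to89.T3UnitScaleTilt (θBal)
open Literature.MathematicalPhysics.QuantumFieldTheory.Balaban1983to89.T3AlphaInputsAC
open Literature.MathematicalPhysics.QuantumFieldTheory.Balaban1985CMP102
open Literature.MathematicalPhysics.QuantumFieldTheory.Balaban1985CMP102.Setting
open Summit.QuantumFields.Balaban3D.Carriers
open Summit.QuantumFields.Balaban3D.Proofs.Primitives
open Summit.QuantumFields.Balaban3D.Proofs.Inputs (LaneConsts)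
open Summit.QuantumFields.Balaban3D.Proofs.TowerAC
open Summit.QuantumFields.Balaban3D.Proofs.StandardAC
open Summit.QuantumFields.Balaban3D.Proofs.InputsAC
open Summit.QuantumFields.Balaban3D.Proofs.Bound55Masses (chiB chiB_nonneg)
open Summit.QuantumFields.Balaban3D.Proofs.MassesPAC

/-! ## §1 The v3 row at the trivial new history IS the mass-free trivial-history row, when the window covers `χB_k(triv′)` (lane-generic) -/

section Generic

variable {L : ℕ} (𝔎 : LaneConsts L) {S : Scales L} {G : Type} [GaugeGroup G] [MeasurableSpace G] [HaarData G]
  {E : Type} [NormedAddCommGroup E] [NormedSpace ℂ E]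
  (X : ExternalInputsAC S G) (𝔖 : ∀ k, StepSeries S G E (nblkOf S 𝔎.carrier k) k)
  (win : (k : ℕ) → Hist S.P (k + 1) → Set (GaugeField S.P (k + 1) G))

/-- **`Fibre55WinAC` AT `h′ = triv` ⇒ THE MASS-FREE TRIVIAL-HISTORY ROW, WHEN THE WINDOW COVERS `χB_k(triv′)`**: for the lane's AC tower over any scales
and AC inputs and ANY window family, the v3 residual row (R-g18-a: windowed pinned weight `wtP_k(proj h′)` on the left) at the trivial new history of step `k`
(standing range `k ≤ m + K`), together with `χB_k(triv′)(U) ≠ 0 ⇒ wtP_k(triv_k)(U) = 1` (the window of the old trivial history covers the small-field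
factor; automatic at `k = 0`; for print's (40) windows `AlphaInputsT3AC.wtP_admWindowT3_triv_eq_one`), gives
`T_k[χB_k(triv′)·e^{(41)_k-exponent at triv}] ≤ᵐ e^{(55)·(58)-exponent at triv′}` — `w_k(triv′) = 1`, `M_{k+1}(triv′) = 1`, `𝟙[window] ≤ 1`
(`LogComparisonRepAtHeights.fibre55Triv_of_windowedRow` read on the row's definition). [cite: Balaban1985UV3, (40)-(41) p.266, (55) p.269 and p.272 L32-33] -/
theorem LogComparisonRepAtHeights.fibre55Triv_of_fibre55WinAC (k : ℕ) (hk : k ≤ S.P.m + S.P.K)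
    (hrow : PinnedStep.Fibre55WinAC 𝔎 X 𝔖 win k (Hist.triv S.P (k + 1)))
    (hsupp : ∀ U : GaugeField S.P k G,
      chiB 𝔎.carrier.M₁ (rcolOf S 𝔎.carrier) (eps1Of S 𝔎.carrier) k (Hist.triv S.P (k + 1)) U ≠ 0 →
        PinnedStep.wtP 𝔎 X win k (Hist.triv S.P k) U = 1) :
    (rnTransport (X.av k).avg (fun U =>
        chiB 𝔎.carrier.M₁ (rcolOf S 𝔎.carrier) (eps1Of S 𝔎.carrier) k (Hist.triv S.P (k + 1)) U *
          Real.exp (-((towerOfAC 𝔎 X 𝔖).mainT k (Hist.triv S.P k) U) + (towerOfAC 𝔎 X 𝔖).Pint k (Hist.triv S.P k) U - (towerOfAC 𝔎 X 𝔖).Ecst k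
            + (towerOfAC 𝔎 X 𝔖).Zterm k (Hist.triv S.P k) + (towerOfAC 𝔎 X 𝔖).Rm k)))
      ≤ᵐ[fieldMeasure S.P (k + 1) G] fun V =>
        Real.exp (-((towerOfAC 𝔎 X 𝔖).mainT (k + 1) (Hist.triv S.P (k + 1)) V) - (towerOfAC 𝔎 X 𝔖).Ecst k
          + ((piecesAC 𝔎 X 𝔖 k).logσ₀ + (piecesAC 𝔎 X 𝔖 k).dg * Real.log ((towerOfAC 𝔎 X 𝔖).g k)) * (piecesAC 𝔎 X 𝔖 k).starB (Hist.triv S.P (k + 1))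
          + (piecesAC 𝔎 X 𝔖 k).logZU (Hist.triv S.P (k + 1)) V + (piecesAC 𝔎 X 𝔖 k).Pold (Hist.triv S.P (k + 1)) V
          + (towerOfAC 𝔎 X 𝔖).Zterm k ((piecesAC 𝔎 X 𝔖 k).proj (Hist.triv S.P (k + 1))) + (towerOfAC 𝔎 X 𝔖).Rm k
          + (piecesAC 𝔎 X 𝔖 k).logFl (Hist.triv S.P (k + 1)) V) :=
  LogComparisonRepAtHeights.fibre55Triv_of_windowedRow 𝔎 X 𝔖 win k hk hrow hsupp

end Generic

/-! ## §2 Conjunct (A) at the T³ datum from the v2 package and the lane's v3 row at the trivial history -/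

section T3

variable {F : T3Family} {𝔠 : AlphaConsts F.L (suGroupModel 2).N} {a₀ a₁ : ℝ}
  (h : AlphaInputsT3AC.OfV2At F 𝔠 a₀ a₁) (hc : 0 < a₀ ∧ 0 < a₁ ∧ 𝔠.B₃ * a₁ ≤ a₀) (γ : ℝ) (hγ : 0 < γ)
  (hγ1 : γ ≤ (min 𝔠.gamma0 1) ^ 2) (π : AlphaInputsT3AC.PolymerT3 F)

/-- **CONJUNCT (A) OF v5h STUB 3′ AT THE LANE'S DATUM ⟸ `OfV2At` ∧ THE LANE'S v3 ROW `Fibre55WinAC` AT THE TRIVIAL HISTORY FOR A WINDOW FAMILY COVERING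
`χB_k(triv′)` ∧ THE ADAPTER'S THRESHOLDS**: for ANY window family `win` of the lane whose level-`k` window of the old trivial history covers the small-field
factor `χB_k(triv′)` (`hsupp`, the R-g18-a proviso; print's (40) windows qualify, `repAtHeights_dataT3c_of_fibre55WinAdm`), if `PinnedStep.Fibre55WinAC` holds at
the trivial new history of every step `k < K` of every run `K` of the v2 package `OfV2At.pkgAtV2`, then `RepAtHeights (OfV2At.dataT3c …) 𝔠.b₀ 𝔠.p₀ ε₀` (through
§1 and p505372 `repAtHeights_dataT3c_of_fibre55Triv`).  No Haar compatibility, no floored mass. [cite: Balaban1985UV3, (41) p.266, (47) p.267 and (55)-(58) pp.269-270] -/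
theorem AlphaInputsT3AC.OfV2At.repAtHeights_dataT3c_of_fibre55Win
    (win : (K k : ℕ) → Hist (F.P K) (k + 1) → Set (GaugeField (F.P K) (k + 1) (Matrix.specialUnitaryGroup (Fin 2) ℂ)))
    (hwin : ∀ (K k : ℕ), k + 1 ≤ K →
      PinnedStep.Fibre55WinAC 𝔠.lane (h.pkgAtV2 hc γ hγ hγ1 K).X (h.pkgAtV2 hc γ hγ hγ1 K).𝔖 (win K) k (Hist.triv (F.P K) (k + 1)))
    (hsupp : ∀ (K k : ℕ), k + 1 ≤ K → ∀ U : GaugeField (F.P K) k (Matrix.specialUnitaryGroup (Fin 2) ℂ),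
      chiB 𝔠.lane.carrier.M₁ (rcolOf (T3Scales F γ hγ (hγ1.trans (sq_min_one_le _ 𝔠.gamma0_pos)) K) 𝔠.lane.carrier)
          (eps1Of (T3Scales F γ hγ (hγ1.trans (sq_min_one_le _ 𝔠.gamma0_pos)) K) 𝔠.lane.carrier) k (Hist.triv (F.P K) (k + 1)) U ≠ 0 →
        PinnedStep.wtP 𝔠.lane (h.pkgAtV2 hc γ hγ hγ1 K).X (win K) k (Hist.triv (F.P K) k) U = 1)
    (ε₀ : ℝ) (hε : 0 < ε₀) (hhi : ε₀ ≤ a₀)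
    (ha₁ : ∀ n, θBal F.L γ 𝔠.b₀ 𝔠.p₀ n ≤ a₁) (hlo : ∀ n, 𝔠.B₃ * θBal F.L γ 𝔠.b₀ 𝔠.p₀ n ≤ ε₀)
    (h4 : ∀ n, 4 * θBal F.L γ 𝔠.b₀ 𝔠.p₀ n < ε₀) :
    RepAtHeights (h.dataT3c hc γ hγ hγ1 π) 𝔠.b₀ 𝔠.p₀ ε₀ := by
  refine h.repAtHeights_dataT3c_of_fibre55Triv hc γ hγ hγ1 π (fun K k hk => ?_) ε₀ hε hhi ha₁ hlo h4
  have hkm : k ≤ (F.P K).m + (F.P K).K := by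
    show k ≤ F.m + K
    omega
  exact LogComparisonRepAtHeights.fibre55Triv_of_fibre55WinAC 𝔠.lane (h.pkgAtV2 hc γ hγ hγ1 K).X (h.pkgAtV2 hc γ hγ hγ1 K).𝔖 (win K) k hkm
    (hwin K k hk) (hsupp K k hk)

/-- **THE SAME FOR PRINT'S (40) WINDOWS, THE COVERING DISCHARGED**: if `PinnedStep.Fibre55WinAC` holds at the trivial new history of every step `k < K` of every
run `K` of the v2 package for the admissible window family `AlphaInputsT3AC.admWindowT3` (the rows of `OfV2At.Fibre55WinRows` at `h′ = triv`), then
`RepAtHeights (OfV2At.dataT3c …) 𝔠.b₀ 𝔠.p₀ ε₀` — `AlphaInputsT3AC.wtP_admWindowT3_triv_eq_one` supplies `hsupp`: for this family NOTHING downstream of the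
trivial row changes under R-g18-a. [cite: Balaban1985UV3, (40)-(41) p.266, (47) p.267 and (55)-(58) pp.269-270] -/
theorem AlphaInputsT3AC.OfV2At.repAtHeights_dataT3c_of_fibre55WinAdm
    (hwin : ∀ (K k : ℕ), k + 1 ≤ K →
      PinnedStep.Fibre55WinAC 𝔠.lane (h.pkgAtV2 hc γ hγ hγ1 K).X (h.pkgAtV2 hc γ hγ hγ1 K).𝔖 (AlphaInputsT3AC.admWindowT3 F 𝔠 γ hγ hγ1 K) k
        (Hist.triv (F.P K) (k + 1)))
    (ε₀ : ℝ) (hε : 0 < ε₀) (hhi : ε₀ ≤ a₀)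
    (ha₁ : ∀ n, θBal F.L γ 𝔠.b₀ 𝔠.p₀ n ≤ a₁) (hlo : ∀ n, 𝔠.B₃ * θBal F.L γ 𝔠.b₀ 𝔠.p₀ n ≤ ε₀)
    (h4 : ∀ n, 4 * θBal F.L γ 𝔠.b₀ 𝔠.p₀ n < ε₀) :
    RepAtHeights (h.dataT3c hc γ hγ hγ1 π) 𝔠.b₀ 𝔠.p₀ ε₀ :=
  h.repAtHeights_dataT3c_of_fibre55Win hc γ hγ hγ1 π (fun K => AlphaInputsT3AC.admWindowT3 F 𝔠 γ hγ hγ1 K) hwin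
    (fun K k hk U hU => AlphaInputsT3AC.wtP_admWindowT3_triv_eq_one hγ1 (h.pkgAtV2 hc γ hγ hγ1 K).X k (by omega) U hU) ε₀ hε hhi ha₁ hlo h4

end T3

end Summit.QuantumFields.YangMills.Theorems

end
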